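import Summits.ResolutionOfSingularities.ResolutionOfSingularities.Theorems.RadicialJungCleanModelsSufficeGameEndChart
import Summits.ResolutionOfSingularities.ResolutionOfSingularities.Theorems.RadicialJungCleanModelsSufficeGameEndProportional
import Summits.ResolutionOfSingularities.ResolutionOfSingularities.Theorems.RadicialJungCleanModelsSufficeChartsCompat

/-!
# Route `RadicialJung`, crux `CleanModelsSuffice`, line `Sketch`: the END STATE of the game —
# two Kummer charts at a common point differ by units

Helper for the registered stub `stub_gameEndResolves` of the skeleton of
`Summit.ResolutionOfSingularities.ResolutionOfSingularities.Theses.RadicialJung.CleanModelsSuffice`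
(stmt-ResolutionOfSingularities-15883). For two toroidal points `v, v'` of an end state `S` and a
point `w ∈ U' v ∩ U' v'`, the boundary sections of `v` and of `v'` vanishing at `w` both cut out the
exceptional divisors CHARGED AT `w` (good neighbourhoods, charge constancy), so they are matched by
a bijection `σ` (inverse `τ`) with associated germs (they generate the stalks at `w` of the same
global divisors); and their normalised exponents are proportional modulo `p`
(`aK v k ≡ cN_v a_v(D)`, `a_v(D) ≡ μ_v a_w(D)` by `exists_mul_modEq`, same for `v'`). Feeding this to
`exists_associated_weightMonomial` (`…ChartsCompat`) and comparing `p`-th powers: **every value of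
the Kummer chart of `v` at `w` is a unit multiple, in `integralClosure 𝒪_{V,w} L`, of a value of the
Kummer chart of `v'`** (`exists_associated_kci`).
-/

noncomputable section

set_option linter.dupNamespace false -- mandated namespace of this single-conjunct summit

open CategoryTheory AlgebraicGeometry TopologicalSpace IsLocalRing
open Literature.AlgebraicGeometry.Resolution

namespace Summit.ResolutionOfSingularities.ResolutionOfSingularities.Theorems.RadicialJung.CleanModelsSuffice

attribute [local instance] stalkAlgebra isScalarTower_stalkAlgebra

namespace GameState

variable {p : ℕ} {V₀ : Scheme.{0}} [IsIntegral V₀] {L : Type} [Field L] [Algebra V₀.functionField L]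
  {V : Scheme.{0}} [IsIntegral V] {π : V ⟶ V₀} [IsDominant π] (S : GameState p V₀ L V π)
  [Algebra V.functionField L]

/-! ## Matching the vanishing sections of two charts -/

/-- A boundary section of `v` vanishing at `w ∈ U' v ∩ U' v'` is one of the boundary sections of
`v'` vanishing at `w`, with associated germ. [folklore] -/
theorem exists_match (H : S.EndHyp) {v v' : V} (hv : v ∈ S.tor) (hv' : v' ∈ S.tor) (w : V)
    (hw : w ∈ S.U' H hv) (hw' : w ∈ S.U' H hv') (k : Fin (S.nC v + 1))
    (hk : S.tw H hv w hw k ∈ maximalIdeal (V.presheaf.stalk w)) :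
    ∃ k' : Fin (S.nC v' + 1), (S.divOf H.endCond hv' k').1 = (S.divOf H.endCond hv k).1 ∧
      S.tw H hv' w hw' k' ∈ maximalIdeal (V.presheaf.stalk w) ∧
      Associated (S.tw H hv w hw k) (S.tw H hv' w hw' k') := by
  set D := S.divOf H.endCond hv k with hD
  have hwD : w ∈ D.1.support := (S.mem_support_divOf_iff H hv w hw k).mpr hk
  have hchw : S.chargedAt D.1 w :=
    ((S.near_of_mem_U' H hv hw).chargedAt_iff S H D.1).mpr ⟨hwD, S.chargedAt_divOf H.endCond hv k⟩
  have hchv' : S.chargedAt D.1 v' := (((S.near_of_mem_U' H hv' hw').chargedAt_iff S H D.1).mp hchw).2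
  obtain ⟨k', hk'⟩ := S.exists_divOf_eq H.endCond hv' hchv'
  have hwD' : w ∈ (S.divOf H.endCond hv' k').1.support := by rw [hk']; exact hwD
  have hk'' : S.tw H hv' w hw' k' ∈ maximalIdeal (V.presheaf.stalk w) :=
    (S.mem_support_divOf_iff H hv' w hw' k').mp hwD'
  refine ⟨k', hk', hk'', ?_⟩
  rw [← Ideal.span_singleton_eq_span_singleton, ← S.stalkIdeal_divOf_eq_span_tw H hv w hw k,
    ← S.stalkIdeal_divOf_eq_span_tw H hv' w hw' k', hk']

/-- The normalised exponent of the chart of `v` at a section vanishing at `w`, in terms of the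
exponent at `w` of its divisor: `aK v k ≡ cN_v · μ_v · a_w(divOf k) (mod p)`. [folklore] -/
theorem aK_modEq_of_mem (H : S.EndHyp) {v : V} (hv : v ∈ S.tor) (w : V) (hw : w ∈ S.U' H hv)
    (μ : ℕ) (hμ : ∀ (D : V.IdealSheafData) (hDv : D ∈ S.E ∧ v ∈ D.support)
      (hDw : D ∈ S.E ∧ w ∈ D.support), S.chargedAt D w →
      S.a v (S.lab v ⟨D, hDv⟩) ≡ μ * S.a w (S.lab w ⟨D, hDw⟩) [MOD p])
    (k : Fin (S.nC v + 1)) (hk : S.tw H hv w hw k ∈ maximalIdeal (V.presheaf.stalk w)) :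
    S.aK H hv k ≡ S.cN H hv * μ * S.a w (S.lab w ⟨(S.divOf H.endCond hv k).1,
      (S.divOf H.endCond hv k).2.1, (S.mem_support_divOf_iff H hv w hw k).mpr hk⟩) [MOD p] := by
  have hwD : w ∈ (S.divOf H.endCond hv k).1.support := (S.mem_support_divOf_iff H hv w hw k).mpr hk
  have hchw : S.chargedAt (S.divOf H.endCond hv k).1 w :=
    ((S.near_of_mem_U' H hv hw).chargedAt_iff S H _).mpr ⟨hwD, S.chargedAt_divOf H.endCond hv k⟩
  have h1 := S.aK_modEq H hv k
  rw [← S.lab_divOf H.endCond hv k] at h1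
  have h2 := hμ (S.divOf H.endCond hv k).1 (S.divOf H.endCond hv k).2
    ⟨(S.divOf H.endCond hv k).2.1, hwD⟩ hchw
  rw [mul_assoc]
  exact h1.trans (h2.mul_left _)

/-- **The matching data of two charts at a common point**, in the form consumed by
`exists_associated_weightMonomial`. [folklore] -/
theorem exists_compatData (H : S.EndHyp) {v v' : V} (hv : v ∈ S.tor) (hv' : v' ∈ S.tor) (w : V)
    (hw : w ∈ S.U' H hv) (hw' : w ∈ S.U' H hv') (S₁ : Finset (Fin (S.nC v + 1)))
    (hS₁ : ∀ k, k ∈ S₁ ↔ S.tw H hv w hw k ∈ maximalIdeal (V.presheaf.stalk w))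
    (S₂ : Finset (Fin (S.nC v' + 1)))
    (hS₂ : ∀ k, k ∈ S₂ ↔ S.tw H hv' w hw' k ∈ maximalIdeal (V.presheaf.stalk w)) :
    ∃ (σ : Fin (S.nC v + 1) → Fin (S.nC v' + 1)) (τ : Fin (S.nC v' + 1) → Fin (S.nC v + 1)) (μ : ℕ),
      (∀ k ∈ S₁, σ k ∈ S₂ ∧ τ (σ k) = k ∧ Associated (S.tw H hv w hw k) (S.tw H hv' w hw' (σ k)) ∧
        S.aK H hv k ≡ μ * S.aK H hv' (σ k) [MOD p]) ∧
      (∀ k' ∈ S₂, τ k' ∈ S₁ ∧ σ (τ k') = k') := by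
  classical
  haveI : Fact p.Prime := ⟨H.prime⟩
  have hm := fun k hk => S.exists_match H hv hv' w hw hw' k hk
  have hm' := fun k' hk' => S.exists_match H hv' hv w hw' hw k' hk'
  let σ : Fin (S.nC v + 1) → Fin (S.nC v' + 1) := fun k =>
    if hk : S.tw H hv w hw k ∈ maximalIdeal (V.presheaf.stalk w) then (hm k hk).choose else 0
  let τ : Fin (S.nC v' + 1) → Fin (S.nC v + 1) := fun k' =>
    if hk' : S.tw H hv' w hw' k' ∈ maximalIdeal (V.presheaf.stalk w) then (hm' k' hk').choose else 0
  have hσ : ∀ k (hk : S.tw H hv w hw k ∈ maximalIdeal (V.presheaf.stalk w)),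
      (S.divOf H.endCond hv' (σ k)).1 = (S.divOf H.endCond hv k).1 ∧
      S.tw H hv' w hw' (σ k) ∈ maximalIdeal (V.presheaf.stalk w) ∧
      Associated (S.tw H hv w hw k) (S.tw H hv' w hw' (σ k)) := by
    intro k hk
    simp only [σ, dif_pos hk]
    exact (hm k hk).choose_spec
  have hτ : ∀ k' (hk' : S.tw H hv' w hw' k' ∈ maximalIdeal (V.presheaf.stalk w)),
      (S.divOf H.endCond hv (τ k')).1 = (S.divOf H.endCond hv' k').1 ∧
      S.tw H hv w hw (τ k') ∈ maximalIdeal (V.presheaf.stalk w) := by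
    intro k' hk'
    simp only [τ, dif_pos hk']
    exact ⟨(hm' k' hk').choose_spec.1, (hm' k' hk').choose_spec.2.1⟩
  -- the scalars
  obtain ⟨μ₁, hμ₁, hμ₁'⟩ := S.exists_mul_modEq H (S.near_of_mem_U' H hv hw)
  obtain ⟨μ₂, hμ₂, hμ₂'⟩ := S.exists_mul_modEq H (S.near_of_mem_U' H hv' hw')
  set A₁ : ZMod p := (S.cN H hv : ZMod p) * μ₁ with hA₁
  set A₂ : ZMod p := (S.cN H hv' : ZMod p) * μ₂ with hA₂
  have hA₂0 : A₂ ≠ 0 := by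
    refine mul_ne_zero ?_ ?_ <;> rw [Ne, ZMod.natCast_eq_zero_iff]
    · exact S.not_dvd_cN H hv'
    · exact hμ₂
  refine ⟨σ, τ, (A₁ * A₂⁻¹).val, fun k hk => ?_, fun k' hk' => ?_⟩
  · have hk0 := (hS₁ k).mp hk
    obtain ⟨hdiv, hmem, hassoc⟩ := hσ k hk0
    refine ⟨(hS₂ _).mpr hmem, ?_, hassoc, ?_⟩
    · obtain ⟨hdiv', -⟩ := hτ (σ k) hmem
      rw [hdiv] at hdiv'
      exact S.divOf_injective H.endCond hv (Subtype.ext hdiv')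
    · have e1 := S.aK_modEq_of_mem H hv w hw μ₁ hμ₁' k hk0
      have e2 := S.aK_modEq_of_mem H hv' w hw' μ₂ hμ₂' (σ k) hmem
      -- the exponents at `w` of the common divisor agree
      have hlab : S.lab w ⟨(S.divOf H.endCond hv' (σ k)).1, (S.divOf H.endCond hv' (σ k)).2.1,
          (S.mem_support_divOf_iff H hv' w hw' (σ k)).mpr hmem⟩ =
          S.lab w ⟨(S.divOf H.endCond hv k).1, (S.divOf H.endCond hv k).2.1,
          (S.mem_support_divOf_iff H hv w hw k).mpr hk0⟩ := by
        congr 1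
        exact Subtype.ext hdiv
      rw [hlab] at e2
      set ew := S.a w (S.lab w ⟨(S.divOf H.endCond hv k).1, (S.divOf H.endCond hv k).2.1,
          (S.mem_support_divOf_iff H hv w hw k).mpr hk0⟩) with hew
      rw [← ZMod.natCast_eq_natCast_iff] at e1 e2 ⊢
      push_cast at e1 e2 ⊢
      rw [ZMod.natCast_zmod_val, e1, e2, ← hA₁]
      change A₁ * ew = A₁ * A₂⁻¹ * (A₂ * ew)
      field_simp
  · have hk0 := (hS₂ k').mp hk'
    obtain ⟨hdiv, hmem⟩ := hτ k' hk0
    refine ⟨(hS₁ _).mpr hmem, ?_⟩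
    obtain ⟨hdiv', -, -⟩ := hσ (τ k') hmem
    rw [hdiv] at hdiv'
    exact S.divOf_injective H.endCond hv' (Subtype.ext hdiv')

/-! ## The two Kummer charts at `w` differ by units -/

/-- **Every value of the Kummer chart of `v` at `w` is a unit multiple, in
`integralClosure 𝒪_{V,w} L`, of a value of the Kummer chart of `v'`.** [folklore] -/
theorem exists_associated_kci (H : S.EndHyp) {v v' : V} (hv : v ∈ S.tor) (hv' : v' ∈ S.tor) (w : V)
    (hw : w ∈ S.U' H hv) (hw' : w ∈ S.U' H hv') (c : kummerMonoid p (S.aK H hv)) :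
    ∃ c' : kummerMonoid p (S.aK H hv'),
      Associated (S.kci H hv w hw (Multiplicative.ofAdd c)) (S.kci H hv' w hw' (Multiplicative.ofAdd c')) := by
  classical
  set S₁ : Finset (Fin (S.nC v + 1)) := Finset.univ.filter fun k =>
    S.tw H hv w hw k ∈ maximalIdeal (V.presheaf.stalk w) with hS₁def
  have hS₁ : ∀ k, k ∈ S₁ ↔ S.tw H hv w hw k ∈ maximalIdeal (V.presheaf.stalk w) :=
    fun k => by simp [hS₁def]
  set S₂ : Finset (Fin (S.nC v' + 1)) := Finset.univ.filter fun k =>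
    S.tw H hv' w hw' k ∈ maximalIdeal (V.presheaf.stalk w) with hS₂def
  have hS₂ : ∀ k, k ∈ S₂ ↔ S.tw H hv' w hw' k ∈ maximalIdeal (V.presheaf.stalk w) :=
    fun k => by simp [hS₂def]
  obtain ⟨σ, τ, μ, hσ, hτ⟩ := S.exists_compatData H hv hv' w hw hw' S₁ hS₁ S₂ hS₂
  obtain ⟨c', hc', hXY⟩ := exists_associated_weightMonomial p (S.tw H hv w hw) (S.aK H hv)
    (S.tw H hv' w hw') (S.aK H hv') (S.aK_zero H hv') S₁ hS₁ S₂ hS₂ σ τ μ hσ hτ c c.2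
  refine ⟨⟨c', hc'⟩, ?_⟩
  obtain ⟨u, hu⟩ := hXY
  refine (associated_of_pow_eq_unit_mul_pow p H.prime.pos _ _ (u : V.presheaf.stalk w) u.isUnit ?_).symm
  rw [S.coe_kci_pow, S.coe_kci_pow]
  change algebraMap (V.presheaf.stalk w) L (∏ k, S.tw H hv' w hw' k ^
      (kummerWeight p (S.aK H hv') c' k).toNat) =
    algebraMap (V.presheaf.stalk w) L u * algebraMap (V.presheaf.stalk w) L
      (∏ k, S.tw H hv w hw k ^ (kummerWeight p (S.aK H hv) c k).toNat)
  rw [← hu, map_mul, mul_comm]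

end GameState

/-- Two Kummer charts of an end state at a common point differ by units (explicit-binder form,
the registered interface of this helper file). [folklore] -/
theorem gameState_exists_associated_kci {p : ℕ} {V₀ : Scheme.{0}} [IsIntegral V₀] {L : Type}
    [Field L] [Algebra V₀.functionField L] {V : Scheme.{0}} [IsIntegral V] {π : V ⟶ V₀} [IsDominant π]
    (S : GameState p V₀ L V π) [Algebra V.functionField L] (H : S.EndHyp) {v v' : V}
    (hv : v ∈ S.tor) (hv' : v' ∈ S.tor) (w : V) (hw : w ∈ S.U' H hv) (hw' : w ∈ S.U' H hv')
    (c : kummerMonoid p (S.aK H hv)) :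
    ∃ c' : kummerMonoid p (S.aK H hv'),
      Associated (S.kci H hv w hw (Multiplicative.ofAdd c)) (S.kci H hv' w hw' (Multiplicative.ofAdd c')) :=
  S.exists_associated_kci H hv hv' w hw hw' c

end Summit.ResolutionOfSingularities.ResolutionOfSingularities.Theorems.RadicialJung.CleanModelsSuffice

end
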